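import Summits.RiemannHypothesis.RiemannHypothesis.Theorems.TiltedLandingLaw421R3LandingDoor
import Summits.RiemannHypothesis.RiemannHypothesis.Theorems.TiltedLandingLaw421R3RateSplit
import Summits.RiemannHypothesis.RiemannHypothesis.Theorems.TiltedLandingLaw421R3RealCritClose
import Summits.RiemannHypothesis.RiemannHypothesis.Theses.EarlyAppointments

/-! # trkD_v6q (half) — skeleton for `TiltedLandingLaw421R` at `halfPurse`: stubs = the residual laws of record after the landing door L
(SUCC `RhW08.LandingDoor.DoorAvailLawQ8` = v7 ∨ L, `…R3LandingDoor`; RATE `RhW08.RateSplit.RateLawsHalfQ`, #1112); director (CA44x).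
`RhW08.LandingDoor.doorAvail8_of_doorAvail7 : DoorAvailLawQ → DoorAvailLawQ8` — the v5q SUCC stub implies this one. -/

namespace Summit.RiemannHypothesis.RiemannHypothesis.Cruxes.TiltedLandingLaw421R.TrkDV6Q

set_option linter.dupNamespace false

theorem stub_doorAvailLawQ8 : RhW08.LandingDoor.DoorAvailLawQ8 := by
  sorry

theorem stub_rateLawsHalfQ : RhW08.RateSplit.RateLawsHalfQ := by
  sorry

theorem TiltedLandingLaw421R_of : Summit.RiemannHypothesis.RiemannHypothesis.Theses.EarlyAppointments.TiltedLandingLaw421R :=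
  RhW08.PurseP.law421Half_of_succ_rate
    (RhW08.LandingDoor.restSuccBotQ_of_doorAvail8 RhW08.ClusterQM.realCritBoundNSig_holds stub_doorAvailLawQ8)
    (RhW08.RateSplit.restRateBotPQ_half_of_rateLaws stub_rateLawsHalfQ)

end Summit.RiemannHypothesis.RiemannHypothesis.Cruxes.TiltedLandingLaw421R.TrkDV6Q
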